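import Literature.NumberTheory.Automorphic.IdeleClassCharacterAutConj
import Literature.NumberTheory.GaloisRepresentations.AdicCompletionUniformizer
import Literature.NumberTheory.ComplexMultiplication.CMAlgebraReflexField
import HarnessLib

/-!
# Liu's field of values `M_μ` of a conjugate symplectic automorphic character is a CM field
# ([Liu21] §4.1, after Def. 4.3; Def. 4.5 (2): `A_μ` "is a CM abelian variety" by `M_μ`)

Topic `NumberTheory/Automorphic`; namespace `Literature.NumberTheory.Automorphic` (grouping sub-namespace
`IdeleClassGroup`, as in the companion files).  **Theorems only: no definition, no instance, no named fact, no
`sorry`** (D-0026).  Sequel of `IdeleClassCharacterAlgebraicTwist` (`IdeleClassGroup.muAlg` = Liu's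
`μ^{alg} = μ·|·|_E^{-1/2}`, `IdeleClassGroup.muAlgValueField` = Liu's `M_μ ⊆ ℂ`, `finiteDimensional_muAlgValueField`
= "`M_μ` … is a number field", `traceField_le_muAlgValueField_of_odd` = "… containing `M'_μ`") and of
`IdeleClassCharacterAutConj` (`IdeleClassGroup.autConj σ ψ e he hodd = σμ`, `(σμ)^{alg}(x) = σ(μ^{alg}(x))` on the
finite ideles).

SOURCE.  Y. Liu, *Fourier–Jacobi cycles and arithmetic relative trace formula*, Camb. J. Math. **9** (2021)
= arXiv:2102.11518 [Liu2021]; TeX source `FJcycle.tex` (md5 `6db49a74122d…`).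

AS PRINTED.  §4.1 (TeX ll. 1922–1928): "We put `μ^{alg} ≔ μ · | |_E^{-1/2}`, which is then algebraic. Denote by
`M_μ ⊆ ℂ` the subfield generated by values `μ^{alg}(x)` for `x ∈ (𝔸_E^∞)^×`, which is a number field containing
`M'_μ`."  Def. 4.5 (2) (ll. 1944–1951): "`A_μ` is an abelian variety over `E`", "`i_μ : M_μ → End_E(A_μ)_ℚ` is a CM
structure" — so `dim A_μ = [M_μ:ℚ]/2` and (Def. 4.5 (2), Remark after it) `A_μ` is a CM abelian variety with complex
multiplication BY THE FIELD `M_μ`; for this to make sense (and for the tree's consumers to form the bundled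
`CMField` `⟨M_μ⟩` and the CM abelian variety `A_{(M_μ, Ψ̃_μ)}` of the pinned junction of transposition item (vi),
cells pub-hodgecm / pub-hodgecm2) `M_μ` must be a CM FIELD.  The paper takes this for granted (it is the standard
fact that the field generated by the values of an algebraic Hecke character of a CM field with non-trivial
infinity type is a CM field: Shimura 1971 §7.8 / Shimura 1998 §18.2 Lemma with Weil 1956); this file PROVES it on the
tree's real carriers.

WHAT IS HERE (`L` a number field, `ψ : IdeleClassGroup L →ₜ* Circle`, `x` an idele with `x_∞ = 1`, `σ : ℂ ≃+* ℂ`).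
* § 1 **the idele norm of a finite idele is rational**: `exists_ratCast_eq_ideleNorm_of_fst_eq_one`
  (`‖x‖ = ∏_{v ∈ S} ‖x_v‖_v`, each `‖x_v‖_v = N(v)^{n_v}`), hence fixed by every automorphism of `ℂ`
  (`map_ideleNorm_of_fst_eq_one`).
* § 2 **`μ^{alg}(x) · \overline{μ^{alg}(x)} = ‖x‖⁻¹`** (`coe_muAlg_mul_conj`, from `|μ^{alg}(x)| = ‖x‖^{-1/2}`).
* § 3 **conjugation commutes with `Aut(ℂ)` on `M_μ`**: for `ψ` of odd unitary ∞-type on a totally complex `L`,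
  `σ(\overline{μ^{alg}(x)}) = \overline{σ(μ^{alg}(x))}` (`map_conj_coe_muAlg_of_fst_eq_one`: both sides are
  `‖x‖⁻¹ · σ(μ^{alg}(x))⁻¹`, because `σ(μ^{alg}(x)) = (σμ)^{alg}(x)` again has absolute value `‖x‖^{-1/2}`), hence
  at every point of `M_μ` (`conj_comm_of_mem_muAlgValueField`, Shimura's "easily verified directly").
* § 4 **`M_μ` is a number field, totally real or CM** (`numberField_muAlgValueField`,
  `isTotallyReal_or_isCMField_muAlgValueField`, by the tree's `Aut(ℂ)` criterion
  `NumberFields.isTotallyReal_or_isCMField_of_conj_comm_apply`), and **CM when `L` is a CM field**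
  (`isCMField_muAlgValueField`: `M_μ ⊇ M'_μ = traceField Φ_μ`, a CM field, so `M_μ` is not totally real);
  for conjugate symplectic `ψ`: **`IsConjugateSymplectic.numberField_muAlgValueField`**,
  **`IsConjugateSymplectic.isCMField_muAlgValueField`**.

NOT HERE.  (i) The identification of the cell pub-hodgecm2 typing `Liu2021.fieldOfValues E μ`
(`IntermediateField.adjoin` form, proposal p277833) with `muAlgValueField` (a bridge lemma once that file is in the
tree).  (ii) `[M_μ : M'_μ]` or any finer structure of `M_μ`.

## References

* [Liu2021] Y. Liu, *Fourier–Jacobi cycles and arithmetic relative trace formula*, Camb. J. Math. 9 (2021),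
  no. 1, 1–147, arXiv:2102.11518 — §4.1, text after Def. 4.3 (TeX ll. 1922–1928); Def. 4.5 (2) (ll. 1944–1951).
* [Shimura1998] G. Shimura, *Abelian Varieties with Complex Multiplication and Modular Functions* (1998), §18.2
  Lemma (i)–(iv) (totally real or CM fields via conjugation commuting with all embeddings).
* [Weil1956] A. Weil, *On a certain type of characters of the idèle-class group of an algebraic number-field*,
  Proc. Int. Symp. Tokyo–Nikko 1955 (1956), 1–7, §1.
* [CasselsFrohlichANT1967] J. W. S. Cassels, A. Fröhlich (eds.), *Algebraic Number Theory* (1967), Ch. II §16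
  (local components of the idele norm).
-/

set_option autoImplicit false

noncomputable section

open scoped NNReal ComplexConjugate
open NumberField IsDedekindDomain NumberField.InfinitePlace

namespace Literature.NumberTheory.Automorphic

open GaloisRepresentations

namespace IdeleClassGroup

variable {L : Type} [Field L] [NumberField L]

/-! ## § 1. The idele norm of a finite idele is rational -/

section FiniteIdeleNorm

/-- `‖y‖ = 1 ↔ |y|_v = 1` in `L_v` (Mathlib's norm on the completion is the rank-one norm of the valuation).
[folklore] -/
private theorem norm_adicCompletion_eq_one_iff' {v : HeightOneSpectrum (𝓞 L)} {y : v.adicCompletion L} :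
    ‖y‖ = 1 ↔ Valued.v y = 1 := by
  rw [le_antisymm_iff, le_antisymm_iff, Valued.toNormedField.norm_le_one_iff,
    Valued.toNormedField.one_le_norm_iff]

/-- **The idele norm of a finite idele is a rational number**: for `x ∈ 𝕀_L` with `x_∞ = 1`,
`‖x‖ = ∏_{v ∈ S} ‖x_v‖_v` over the finitely many `v` where `x_v` is not a unit, and `‖x_v‖_v = N(v)^{n_v}`.
[cite: CasselsFrohlichANT1967, Ch. II §16] -/
theorem exists_ratCast_eq_ideleNorm_of_fst_eq_one (x : ideleGroup L) (hx : (x : AdeleRing (𝓞 L) L).1 = 1) :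
    ∃ q : ℚ, (q : ℝ) = GaloisRepresentations.ideleNorm x := by
  classical
  have hfin := ideleGroup_valued_snd_eventually_eq_one x
  rw [Filter.eventually_cofinite] at hfin
  set S : Finset (HeightOneSpectrum (𝓞 L)) := hfin.toFinset with hS
  have hsupp : (Function.mulSupport fun v : HeightOneSpectrum (𝓞 L) => ‖(x : AdeleRing (𝓞 L) L).2 v‖) ⊆
      (S : Set (HeightOneSpectrum (𝓞 L))) := by
    intro v hv
    rw [hS, Set.Finite.coe_toFinset]
    intro h1
    exact hv (norm_adicCompletion_eq_one_iff'.2 h1)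
  refine ⟨∏ v ∈ S, ((Ideal.absNorm v.asIdeal : ℕ) : ℚ) ^
      (WithZero.unzero ((Valuation.ne_zero_iff Valued.v).mpr
        (Units.mk0 ((x : AdeleRing (𝓞 L) L).2 v) (ideleGroup_snd_ne_zero x v)).ne_zero)).toAdd, ?_⟩
  rw [GaloisRepresentations.ideleNorm, finprod_eq_prod_of_mulSupport_subset _ hsupp]
  have h1 : (∏ w : InfinitePlace L, ‖(x : AdeleRing (𝓞 L) L).1 w‖ ^ w.mult) = 1 :=
    Finset.prod_eq_one fun w _ => by
      have hw : (x : AdeleRing (𝓞 L) L).1 w = 1 := by rw [hx]; rfl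
      rw [hw, norm_one, one_pow]
  rw [h1, one_mul, Rat.cast_prod]
  refine Finset.prod_congr rfl fun v _ => ?_
  rw [Rat.cast_zpow, Rat.cast_natCast]
  exact (Ultrametric.AdicCompletion.norm_units_eq_absNorm_zpow L v
    (Units.mk0 ((x : AdeleRing (𝓞 L) L).2 v) (ideleGroup_snd_ne_zero x v))).symm

/-- **Every automorphism of `ℂ` fixes the idele norm of a finite idele** (a rational number).
[cite: CasselsFrohlichANT1967, Ch. II §16] -/
theorem map_ideleNorm_of_fst_eq_one (σ : ℂ ≃+* ℂ) (x : ideleGroup L) (hx : (x : AdeleRing (𝓞 L) L).1 = 1) :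
    σ ((GaloisRepresentations.ideleNorm x : ℝ) : ℂ) = ((GaloisRepresentations.ideleNorm x : ℝ) : ℂ) := by
  obtain ⟨q, hq⟩ := exists_ratCast_eq_ideleNorm_of_fst_eq_one x hx
  rw [← hq, Complex.ofReal_ratCast]
  exact map_ratCast σ q

end FiniteIdeleNorm

/-! ## § 2. `μ^{alg}(x) · \overline{μ^{alg}(x)} = ‖x‖⁻¹` -/

section Conj

variable (L)

/-- The idele norm is non-negative (it is the coercion of the `ℝ≥0`-valued `IdeleClassGroup.ideleNorm`).
[folklore] -/
private theorem ideleNorm_nonneg' (x : ideleGroup L) : 0 ≤ GaloisRepresentations.ideleNorm x := by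
  rw [← coe_ideleNorm]; exact NNReal.coe_nonneg _

/-- **`μ^{alg}(x) · \overline{μ^{alg}(x)} = ‖x‖⁻¹`** for every idele `x` and every unitary `ψ = μ`
(`|μ^{alg}(x)| = ‖x‖^{-1/2}`, `norm_muAlg_apply`). [cite: Liu2021, §4.1 (TeX l. 1922)] -/
theorem coe_muAlg_mul_conj (ψ : IdeleClassGroup L →ₜ* Circle) (x : ideleGroup L) :
    ((muAlg L ψ x : ℂˣ) : ℂ) * conj ((muAlg L ψ x : ℂˣ) : ℂ) =
      (((GaloisRepresentations.ideleNorm x : ℝ) : ℂ))⁻¹ := by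
  rw [Complex.mul_conj, Complex.normSq_eq_norm_sq, norm_muAlg_apply, inv_pow,
    Real.sq_sqrt (ideleNorm_nonneg' L x), Complex.ofReal_inv]

/-- `\overline{μ^{alg}(x)} = ‖x‖⁻¹ · μ^{alg}(x)⁻¹`. [cite: Liu2021, §4.1 (TeX l. 1922)] -/
theorem conj_coe_muAlg (ψ : IdeleClassGroup L →ₜ* Circle) (x : ideleGroup L) :
    conj ((muAlg L ψ x : ℂˣ) : ℂ) =
      (((GaloisRepresentations.ideleNorm x : ℝ) : ℂ))⁻¹ * (((muAlg L ψ x : ℂˣ) : ℂ))⁻¹ := by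
  have hz : ((muAlg L ψ x : ℂˣ) : ℂ) ≠ 0 := (muAlg L ψ x).ne_zero
  rw [← coe_muAlg_mul_conj L ψ x, mul_comm ((muAlg L ψ x : ℂˣ) : ℂ), mul_assoc, mul_inv_cancel₀ hz, mul_one]

end Conj

/-! ## § 3. Conjugation commutes with `Aut(ℂ)` on `M_μ` -/

section ConjComm

variable [IsTotallyComplex L] {ψ : IdeleClassGroup L →ₜ* Circle} {e : InfinitePlace L → ℤ}
  (he : HasInfinityType L ψ e) (hodd : ∀ w, Odd (e w))
include he hodd

/-- **`σ(\overline{μ^{alg}(x)}) = \overline{σ(μ^{alg}(x))}`** for every automorphism `σ` of `ℂ` and every finite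
idele `x` (`x_∞ = 1`), `ψ = μ` of odd unitary ∞-type on a totally complex `L`.  Both sides equal
`‖x‖⁻¹ · σ(μ^{alg}(x))⁻¹`: the left because `\overline{μ^{alg}(x)} = ‖x‖⁻¹ μ^{alg}(x)⁻¹` with `‖x‖ ∈ ℚ` (§ 1), the
right because `σ(μ^{alg}(x)) = (σμ)^{alg}(x)` (`coe_muAlg_autConj_apply_of_fst_eq_one`) is again the value of an
algebraic twist at `x`, of absolute value `‖x‖^{-1/2}`.  (Shimura 1998 §18.2: the values behave like elements of a
CM field under every embedding.) [cite: Liu2021, §4.1 (TeX ll. 1922–1928)] [cite: Shimura1998, §18.2 Lemma] -/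
theorem map_conj_coe_muAlg_of_fst_eq_one (σ : ℂ ≃+* ℂ) {x : ideleGroup L}
    (hx : (x : AdeleRing (𝓞 L) L).1 = 1) :
    σ (conj ((muAlg L ψ x : ℂˣ) : ℂ)) = conj (σ ((muAlg L ψ x : ℂˣ) : ℂ)) := by
  let σ' : ℂ ≃ₐ[ℚ] ℂ := AlgEquiv.ofRingEquiv (f := σ) fun q => by
    rw [eq_ratCast]
    exact map_ratCast σ q
  have hσ : ∀ z : ℂ, σ z = σ' z := fun _ => rfl
  have hval : σ ((muAlg L ψ x : ℂˣ) : ℂ) = ((muAlg L (autConj σ' ψ e he hodd) x : ℂˣ) : ℂ) := by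
    rw [hσ, coe_muAlg_autConj_apply_of_fst_eq_one σ' he hodd hx]
  rw [conj_coe_muAlg L ψ x, map_mul, map_inv₀, map_inv₀, map_ideleNorm_of_fst_eq_one σ x hx, hval,
    conj_coe_muAlg L (autConj σ' ψ e he hodd) x]

/-- **Complex conjugation commutes with every automorphism of `ℂ` at every point of `M_μ`** (the subfield
generated by the values `μ^{alg}(x)`, `x ∈ (𝔸_E^∞)^×`; the points where it commutes form a subfield,
`NumberFields.conj_comm_of_mem_closure`). [cite: Liu2021, §4.1 (TeX ll. 1926–1928)] [cite: Shimura1998, §18.2 Lemma (ii), proof] -/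
theorem conj_comm_of_mem_muAlgValueField {z : ℂ} (hz : z ∈ muAlgValueField L ψ) (σ : ℂ ≃+* ℂ) :
    σ (conj z) = conj (σ z) := by
  rw [muAlgValueField_eq_closure_range] at hz
  refine NumberFields.conj_comm_of_mem_closure (fun w hw τ => ?_) hz σ
  obtain ⟨y, rfl⟩ := hw
  exact map_conj_coe_muAlg_of_fst_eq_one he hodd τ y.2

/-! ## § 4. `M_μ` is a number field, totally real or CM; CM when `L` is a CM field -/

/-- **`M_μ` is a number field** (`[M_μ : ℚ] < ∞`, `finiteDimensional_muAlgValueField`; characteristic zero as a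
subfield of `ℂ`), for `ψ` of odd unitary ∞-type on a totally complex `L`.
[cite: Liu2021, §4.1, after Def. 4.3 (TeX ll. 1926–1928)] -/
theorem numberField_muAlgValueField : NumberField (muAlgValueField L ψ) :=
  { to_charZero := SubsemiringClass.instCharZero (muAlgValueField L ψ)
    to_finiteDimensional := finiteDimensional_muAlgValueField he hodd }

/-- **`M_μ` is totally real or a CM field** for `ψ` of odd unitary ∞-type on a totally complex `L`: along its
inclusion into `ℂ` complex conjugation commutes with `Aut(ℂ)` (§ 3), and a number field with this property is
totally real or CM (`NumberFields.isTotallyReal_or_isCMField_of_conj_comm_apply`, Shimura 1998 §18.2 / Patrikis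
2019 §2). [cite: Shimura1998, §18.2 Lemma (i)–(iv)] [cite: Liu2021, §4.1 (TeX ll. 1926–1928)] -/
theorem isTotallyReal_or_isCMField_muAlgValueField :
    haveI := numberField_muAlgValueField he hodd
    IsTotallyReal (muAlgValueField L ψ) ∨ IsCMField (muAlgValueField L ψ) := by
  haveI := numberField_muAlgValueField he hodd
  exact NumberFields.isTotallyReal_or_isCMField_of_conj_comm_apply (muAlgValueField L ψ).subtype
    fun σ z => conj_comm_of_mem_muAlgValueField he hodd z.2 σ

end ConjComm

section CM

variable [IsCMField L] {ψ : IdeleClassGroup L →ₜ* Circle} {e : InfinitePlace L → ℤ}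

open ComplexMultiplication in
/-- **Liu's `M_μ` is a CM field** for `ψ = μ` of odd unitary ∞-type `e` on a CM field `L` (in particular for
every conjugate symplectic `μ`): `M_μ` is totally real or CM (§ 3–4), and it contains the reflex field
`M'_μ = traceField Φ_μ` of the CM type `Φ_μ = cmTypeOf e` (`traceField_le_muAlgValueField_of_odd`), which is a CM
field (`isCMField_traceField`) and so contains a non-real number — hence `M_μ` is not totally real.  This is the
fact behind [Liu21] Def. 4.5 (2) ("`i_μ : M_μ → End_E(A_μ)_ℚ` is a CM structure": `A_μ` has complex multiplication
by the CM field `M_μ`). [cite: Liu2021, §4.1 (TeX ll. 1926–1928) and Def. 4.5 (2) (ll. 1944–1951)]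
[cite: Shimura1998, §18.2 Lemma (ii)–(iv)] -/
theorem isCMField_muAlgValueField (he : HasInfinityType L ψ e) (hodd : ∀ w, Odd (e w)) :
    IsCMField (muAlgValueField L ψ) := by
  haveI := numberField_muAlgValueField he hodd
  rcases isTotallyReal_or_isCMField_muAlgValueField he hodd with h | h
  · exfalso
    have hne : ∀ w, e w ≠ 0 := fun w h0 => by
      have := hodd w
      rw [h0] at this
      exact Int.not_odd_zero this
    have hle := traceField_le_muAlgValueField_of_odd he hodd hne
    obtain ⟨w, hw, hwc⟩ := NumberFields.IntermediateField.exists_mem_conj_ne_of_isCMField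
      (traceField (cmTypeOf L e hne)) (isCMField_traceField L (cmTypeOf L e hne))
    have hwM : w ∈ muAlgValueField L ψ := hle hw
    have hreal := NumberField.ComplexEmbedding.isReal_iff.mp
      (@IsTotallyReal.complexEmbedding_isReal _ _ h (muAlgValueField L ψ).subtype)
    exact hwc (RingHom.congr_fun hreal ⟨w, hwM⟩)
  · exact h

/-- **`M_μ` is a number field** for a conjugate symplectic `μ` on a CM field (its ∞-type is odd,
`IsConjugateSymplectic.odd` = [Liu21] Remark 4.2). [cite: Liu2021, §4.1, after Def. 4.3 (TeX ll. 1926–1928)] -/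
theorem IsConjugateSymplectic.numberField_muAlgValueField (hψ : IsConjugateSymplectic L ψ) :
    NumberField (muAlgValueField L ψ) :=
  IdeleClassGroup.numberField_muAlgValueField hψ.hasInfinityType_infinityType hψ.odd_infinityType

/-- **[Liu21] §4.1 / Def. 4.5 (2): `M_μ` is a CM field** for every conjugate symplectic automorphic character
`μ` of a CM field (any weight). [cite: Liu2021, §4.1 (TeX ll. 1926–1928) and Def. 4.5 (2) (ll. 1944–1951)] -/
theorem IsConjugateSymplectic.isCMField_muAlgValueField (hψ : IsConjugateSymplectic L ψ) :
    IsCMField (muAlgValueField L ψ) :=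
  IdeleClassGroup.isCMField_muAlgValueField hψ.hasInfinityType_infinityType hψ.odd_infinityType

/-- The two facts packaged for consumers forming the bundled CM field `⟨M_μ⟩` (cells pub-hodgecm / pub-hodgecm2,
transposition item (vi), the pin `A_μ ⊗_{E,ι₁} ℂ`): `M_μ` is a number field AND a CM field.
[cite: Liu2021, §4.1 (TeX ll. 1926–1928) and Def. 4.5 (2) (ll. 1944–1951)] -/
theorem IsConjugateSymplectic.numberField_and_isCMField_muAlgValueField (hψ : IsConjugateSymplectic L ψ) :
    NumberField (muAlgValueField L ψ) ∧ IsCMField (muAlgValueField L ψ) :=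
  ⟨hψ.numberField_muAlgValueField, hψ.isCMField_muAlgValueField⟩

end CM

end IdeleClassGroup

end Literature.NumberTheory.Automorphic

end
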